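import Literature.MathematicalPhysics.QuantumChemistry.PositivityBlockTraces
import HarnessLib

/-!
# Traces of the `S_z` spin classes of the positivity blocks in a sector `(N_α, N_β) = (a, b)`:
# the per-block a-priori bounds of the a-posteriori semidefinite error bound

Topic `Literature/MathematicalPhysics/QuantumChemistry`; continues `PositivityBlockTraces.lean` (the
full-index trace constants of `T1`, `T2`, `T2′` on the DQG-feasible set and the sub-block rule) at the
level at which the generators of the variational 2-RDM programme actually block their matrices: in an
`S_z`-sector calculation ("in which the basis functions are only eigenfunctions of `Ŝ_z`", Mazziotti 2007
§II.F) every positivity matrix splits into SPIN CLASSES — the one-body blocks `γ_σ`, the pair classes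
`(σ, τ)` of `D`, `Q`, `G`, the triple classes of `T1` and the classes `(σ τ; υ)` of `T2`/`T2′` (two
creators of spins `σ, τ`, one annihilator of spin `υ`) — and the SECTOR ROWS (`Tr γ_σ = N_σ` and the
spin-resolved pair traces `N_α(N_α − 1)`, `N_β(N_β − 1)`, `N_α N_β` of Mazziotti 2007 eqs. (87)–(90), the
fields of `IsDQGFeasibleSector`) fix the trace of EVERY spin class. These traces are the admissible
`τ_j` of the trace form of the Jansson–Chaykin–Keil bound (`JanssonChaykinKeil.theorem_3_2_traceBound`,
`….lmiForm_bound`; Jansson's primal boundedness qualification, arXiv:0707.4366 §4 p.8) block by block;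
a finer block (point-group irreducible, spin-flip quotient) inside a class carries the CLASS constant by
the sub-block rule (`re_sum_diag_submatrix_le_of_posSemidef`).

All sums are over ORDERED site tuples `x, y, z ∈ Λ` (`k = |Λ|` spatial orbitals, `n_σ = N_σ`, i.e.
`n = ![a, b]`); a generator that indexes a same-spin pair class by `x < y` carries one half, a same-spin
triple class by `x < y < z` one sixth of the ordered constant (equal-site rows are null and the diagonal
is symmetric). PROVED here (0 sorry, no definitions), for every sector-DQG-feasible pair:

* one body: `Σ_x γ_{xσ,xσ} = n_σ` (field), `Σ_x (1 − γ)_{xσ,xσ} = k − n_σ` (`sum_oneHole_diag_spin`);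
* `D`: `Σ_{x,y} Γ_{(xσ,yτ),(xσ,yτ)} = n_σ(n_σ − 1)` (`σ = τ`) resp. `n_σ n_τ` (`σ ≠ τ`), all four spin
  pairs (`sum_sum_two_diag_spin`; the `(β, α)` pair by antisymmetry);
* `Q`: class `(σ, σ)`: `(k − n_σ)(k − n_σ − 1)`; class `(σ, τ)`, `σ ≠ τ`: `(k − n_σ)(k − n_τ)`;
* `G` (index `(i, j)` of `G^{ij}_{kl} = δ_{jl} γ_{ik} − Γ^{il}_{kj}`): class `(σ; σ)`: `n_σ(k − n_σ + 1)`;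
  class `(σ; τ)`, `σ ≠ τ`: `n_σ(k − n_τ)`;
* `T1`: class `(σσσ)`: `n_σ(n_σ−1)(n_σ−2) + (k−n_σ)(k−n_σ−1)(k−n_σ−2)`; classes `(σστ)`, `(στσ)`,
  `(τσσ)`, `σ ≠ τ`: `n_σ(n_σ−1) n_τ + (k−n_σ)(k−n_σ−1)(k−n_τ)` ("two particles of spin `σ` and one of
  spin `τ`, or two `σ`-holes and one `τ`-hole");
* `T2` (index `(i, j; k)` ↔ `a†_i a†_j a_k`): class `(σσ; σ)`: `n_σ((n_σ−1)(2−k) + k(k−1))`; class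
  `(στ; τ)`: `k n_τ (k − n_τ + 1)`; class `(στ; σ)`: `k n_σ (k − n_σ + 1)`; class `(σσ; τ)`:
  `k n_σ(n_σ−1) − 2(k−1) n_σ n_τ + k(k−1) n_τ` (`σ ≠ τ`);
* `T2′` corner: `Σ_x T2′_{inr xσ, inr xσ} = n_σ` (the 1-matrix block), so a `T2′` charge class
  `(σσ;σ) ∪ (στ;τ) ∪ {σ}` has trace = the sum of the three constants (halving the first for `x < y`).

Instance (arithmetic, not a decl): [2Fe–2S] active space `(a, b, k) = (15, 15, 20)`: `T2′` charge-`α`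
class (pairs `x<y`) `2 775`, `T2 (αα;β)` (`x<y`) `675`, `T1 (ααβ)` (`x<y`) `1 625`, `T1 (ααα)` (`x<y<z`)
`465`, `G (α;α)+(β;β)` `180`, `D (αβ)` `225`.

WHAT THIS FILE IS NOT: not a statement about a particular generator's member lists (the map from these
ordered classes to a block layout — halving, index order inside `T2′` — is the reader's); not the
spin-ADAPTED (`Ŝ²`) blocking; nothing floating-point. References (pages opened 2026-08-26): Mazziotti
2007 Ch. 3 §II.F eqs. (87)–(90) (sector traces), §II.E.3 p.34 (`n_d, n_q, n_g`) [Mazziotti2007RDMChapter];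
Nakata et al. 2008 §II.A–B (PDF p.5: `T1`, `T2`, `T2′` entries) [NakataEtAl2008]; Jansson 2007 §4 PBQ
p.8 [Jansson2007].
-/

noncomputable section

namespace Literature.MathematicalPhysics.QuantumChemistry

open Matrix Finset Literature.MathematicalPhysics.QuantumLattice
open scoped ComplexOrder

namespace IsDQGFeasibleSector

variable {Λ : Type*} [LinearOrder Λ] [Fintype Λ] {a b : ℕ} {γ : Matrix (Orb Λ) (Orb Λ) ℂ}
  {Γ : Matrix (Orb Λ × Orb Λ) (Orb Λ × Orb Λ) ℂ}

/-! ### The sector rows, spin-generic -/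

/-- `Tr γ_σ = N_σ` for both spins, with `n = ![a, b]`. [cite: Mazziotti2007RDMChapter, §II.F] -/
theorem sum_one_diag_spin (h : IsDQGFeasibleSector a b γ Γ) (σ : Fin 2) :
    ∑ x, γ (orb x σ) (orb x σ) = ![(a : ℂ), (b : ℂ)] σ := by
  fin_cases σ
  · simpa using h.trace_up
  · simpa using h.trace_down

/-- The one-HOLE class: `Σ_x (1 − γ)_{xσ, xσ} = k − N_σ` (the `q1_σ` block of a generator).
[cite: Mazziotti2007RDMChapter, §II.F] -/
theorem sum_oneHole_diag_spin (h : IsDQGFeasibleSector a b γ Γ) (σ : Fin 2) :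
    ∑ x, (1 - γ) (orb x σ) (orb x σ) = (Fintype.card Λ : ℂ) - ![(a : ℂ), (b : ℂ)] σ := by
  simp only [Matrix.sub_apply, Matrix.one_apply_eq, Finset.sum_sub_distrib, Finset.sum_const,
    Finset.card_univ, nsmul_eq_mul, mul_one, h.sum_one_diag_spin σ]

/-- The `(β, α)` pair trace `Σ_{x,y} Γ_{(xβ,yα),(xβ,yα)} = N_α N_β`, from the `(α, β)` row (88) by
antisymmetry in both index pairs. [cite: Mazziotti2007RDMChapter, §II.F eqs. (87)-(88)] -/
theorem trace_downUp (h : IsDQGFeasibleSector a b γ Γ) :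
    ∑ x, ∑ y, Γ (orb x 1, orb y 0) (orb x 1, orb y 0) = (a : ℂ) * (b : ℂ) := by
  have hsw : ∀ x y : Λ, Γ (orb x 1, orb y 0) (orb x 1, orb y 0) =
      Γ (orb y 0, orb x 1) (orb y 0, orb x 1) := fun x y => by
    rw [h.dqg.swap_fst, h.dqg.swap_snd, neg_neg]
  simp_rw [hsw]
  rw [Finset.sum_comm]
  exact h.trace_upDown

/-- The spin-resolved pair traces, all four spin pairs (ordered sites): `Σ_{x,y} Γ_{(xσ,yτ),(xσ,yτ)}`
equals `N_σ(N_σ − 1)` for `σ = τ` and `N_σ N_τ` for `σ ≠ τ` (eqs. (87)–(90); the `(β, α)` pair from the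
`(α, β)` row by antisymmetry in both index pairs). [cite: Mazziotti2007RDMChapter, §II.F eqs. (87)-(90)] -/
theorem sum_sum_two_diag_spin (h : IsDQGFeasibleSector a b γ Γ) (σ τ : Fin 2) :
    ∑ x, ∑ y, Γ (orb x σ, orb y τ) (orb x σ, orb y τ) =
      if σ = τ then ![(a : ℂ), (b : ℂ)] σ * (![(a : ℂ), (b : ℂ)] σ - 1)
      else ![(a : ℂ), (b : ℂ)] σ * ![(a : ℂ), (b : ℂ)] τ := by
  fin_cases σ <;> fin_cases τ
  · simpa using h.trace_upUp
  · simpa using h.trace_upDown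
  · simpa [mul_comm] using h.trace_downUp
  · simpa using h.trace_downDown

/-- The pair traces with the summation order swapped (bookkeeping form).
[cite: Mazziotti2007RDMChapter, §II.F eqs. (87)-(90)] -/
theorem sum_sum_two_diag_spin' (h : IsDQGFeasibleSector a b γ Γ) (σ τ : Fin 2) :
    ∑ x, ∑ y, Γ (orb y σ, orb x τ) (orb y σ, orb x τ) =
      if σ = τ then ![(a : ℂ), (b : ℂ)] σ * (![(a : ℂ), (b : ℂ)] σ - 1)
      else ![(a : ℂ), (b : ℂ)] σ * ![(a : ℂ), (b : ℂ)] τ := by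
  rw [Finset.sum_comm]; exact h.sum_sum_two_diag_spin σ τ

/-- The transposed-diagonal pair sums `Σ_{x,y} Γ_{(xσ,yτ),(yτ,xσ)} = −Σ_{x,y} Γ_{(xσ,yτ),(xσ,yτ)}`
(antisymmetry in the lower pair). [cite: Mazziotti2007RDMChapter, §II.D.1 (iii)] -/
theorem sum_sum_two_transp_spin (h : IsDQGFeasibleSector a b γ Γ) (σ τ : Fin 2) :
    ∑ x, ∑ y, Γ (orb x σ, orb y τ) (orb y τ, orb x σ) =
      -(if σ = τ then ![(a : ℂ), (b : ℂ)] σ * (![(a : ℂ), (b : ℂ)] σ - 1)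
        else ![(a : ℂ), (b : ℂ)] σ * ![(a : ℂ), (b : ℂ)] τ) := by
  rw [← h.sum_sum_two_diag_spin σ τ, ← Finset.sum_neg_distrib]
  refine Finset.sum_congr rfl fun x _ => ?_
  rw [← Finset.sum_neg_distrib]
  exact Finset.sum_congr rfl fun y _ => h.dqg.swap_snd _ _ _

/-- The transposed-diagonal pair sums, summation order swapped.
[cite: Mazziotti2007RDMChapter, §II.D.1 (iii)] -/
theorem sum_sum_two_transp_spin' (h : IsDQGFeasibleSector a b γ Γ) (σ τ : Fin 2) :
    ∑ x, ∑ y, Γ (orb y σ, orb x τ) (orb x τ, orb y σ) =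
      -(if σ = τ then ![(a : ℂ), (b : ℂ)] σ * (![(a : ℂ), (b : ℂ)] σ - 1)
        else ![(a : ℂ), (b : ℂ)] σ * ![(a : ℂ), (b : ℂ)] τ) := by
  rw [Finset.sum_comm]; exact h.sum_sum_two_transp_spin σ τ

/-! ### `Q` and `G` classes -/

/-- **`Q` class `(σ, σ)`** (ordered sites): `Σ_{x,y} Q_{(xσ,yσ),(xσ,yσ)} = (k − N_σ)(k − N_σ − 1)`.
[cite: Mazziotti2007RDMChapter, §II.E.3, p.34] [cite: Jansson2007, §4 PBQ (ii), p.8] -/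
theorem trace_qMap_spin_same (h : IsDQGFeasibleSector a b γ Γ) (σ : Fin 2) :
    ∑ x, ∑ y, qMap γ Γ (orb x σ, orb y σ) (orb x σ, orb y σ) =
      ((Fintype.card Λ : ℂ) - ![(a : ℂ), (b : ℂ)] σ) *
        ((Fintype.card Λ : ℂ) - ![(a : ℂ), (b : ℂ)] σ - 1) := by
  have hA := h.sum_sum_two_diag_spin σ σ
  have hγ := h.sum_one_diag_spin σ
  rw [if_pos rfl] at hA
  simp only [qMap_apply, orb_eq_orb_iff, and_true, if_true, ite_mul, one_mul, zero_mul, mul_one,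
    Finset.sum_add_distrib, Finset.sum_sub_distrib, Finset.sum_ite_eq, Finset.sum_ite_eq',
    Finset.mem_univ, Finset.sum_const, Finset.card_univ, nsmul_eq_mul, hA, hγ, ← Finset.mul_sum]
  ring

/-- **`Q` class `(σ, τ)`, `σ ≠ τ`**: `Σ_{x,y} Q_{(xσ,yτ),(xσ,yτ)} = (k − N_σ)(k − N_τ)`.
[cite: Mazziotti2007RDMChapter, §II.E.3, p.34] [cite: Jansson2007, §4 PBQ (ii), p.8] -/
theorem trace_qMap_spin_ne (h : IsDQGFeasibleSector a b γ Γ) {σ τ : Fin 2} (hστ : σ ≠ τ) :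
    ∑ x, ∑ y, qMap γ Γ (orb x σ, orb y τ) (orb x σ, orb y τ) =
      ((Fintype.card Λ : ℂ) - ![(a : ℂ), (b : ℂ)] σ) * ((Fintype.card Λ : ℂ) - ![(a : ℂ), (b : ℂ)] τ) := by
  have hA := h.sum_sum_two_diag_spin σ τ
  have hγσ := h.sum_one_diag_spin σ
  have hγτ := h.sum_one_diag_spin τ
  have hτσ : τ ≠ σ := fun e => hστ e.symm
  rw [if_neg hστ] at hA
  simp only [qMap_apply, orb_eq_orb_iff, hστ, hτσ, and_false, if_false, if_true, one_mul,
    zero_mul, mul_zero, sub_zero, add_zero, Finset.sum_add_distrib, Finset.sum_sub_distrib,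
    Finset.sum_const, Finset.card_univ, nsmul_eq_mul, hA, hγσ, hγτ, ← Finset.mul_sum]
  ring

/-- **`G` class `(σ; σ)`** (row index `(i, j) = (xσ, yσ)` of `G^{ij}_{kl} = δ_{jl} γ_{ik} − Γ^{il}_{kj}`):
`Σ_{x,y} G_{(xσ,yσ),(xσ,yσ)} = N_σ (k − N_σ + 1)`.
[cite: Mazziotti2007RDMChapter, §II.E.3, p.34] [cite: Jansson2007, §4 PBQ (ii), p.8] -/
theorem trace_gMap_spin_same (h : IsDQGFeasibleSector a b γ Γ) (σ : Fin 2) :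
    ∑ x, ∑ y, gMap γ Γ (orb x σ, orb y σ) (orb x σ, orb y σ) =
      ![(a : ℂ), (b : ℂ)] σ * ((Fintype.card Λ : ℂ) - ![(a : ℂ), (b : ℂ)] σ + 1) := by
  have hA := h.sum_sum_two_diag_spin σ σ
  have hγ := h.sum_one_diag_spin σ
  rw [if_pos rfl] at hA
  simp only [gMap_apply, if_true, Finset.sum_sub_distrib, Finset.sum_const, Finset.card_univ,
    nsmul_eq_mul, hA, hγ, ← Finset.mul_sum]
  ring


/-- **`G` class `(σ; τ)`, `σ ≠ τ`**: `Σ_{x,y} G_{(xσ,yτ),(xσ,yτ)} = N_σ (k − N_τ)`.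
[cite: Mazziotti2007RDMChapter, §II.E.3, p.34] [cite: Jansson2007, §4 PBQ (ii), p.8] -/
theorem trace_gMap_spin_ne (h : IsDQGFeasibleSector a b γ Γ) {σ τ : Fin 2} (hστ : σ ≠ τ) :
    ∑ x, ∑ y, gMap γ Γ (orb x σ, orb y τ) (orb x σ, orb y τ) =
      ![(a : ℂ), (b : ℂ)] σ * ((Fintype.card Λ : ℂ) - ![(a : ℂ), (b : ℂ)] τ) := by
  have hA := h.sum_sum_two_diag_spin σ τ
  have hγ := h.sum_one_diag_spin σ
  rw [if_neg hστ] at hA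
  simp only [gMap_apply, if_true, Finset.sum_sub_distrib, Finset.sum_const, Finset.card_univ,
    nsmul_eq_mul, hA, hγ, ← Finset.mul_sum]
  ring

/-! ### `T2` and `T2′` classes -/

omit [LinearOrder Λ] in
/-- The spin-restricted `k`-sum of the `T2` diagonal at a fixed creator pair `(i, j)` (entry formula of
Nakata et al. (2008) §II.A; no feasibility needed). [cite: NakataEtAl2008, §II.A] -/
theorem sum_t2Map_diag_spin [LinearOrder Λ] (γ : Matrix (Orb Λ) (Orb Λ) ℂ)
    (Γ : Matrix (Orb Λ × Orb Λ) (Orb Λ × Orb Λ) ℂ) (i j : Orb Λ) (υ : Fin 2) :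
    ∑ z, t2Map γ Γ (i, j, orb z υ) (i, j, orb z υ) =
      (Fintype.card Λ : ℂ) * Γ (i, j) (i, j) - ∑ z, Γ (orb z υ, j) (orb z υ, j) -
        ∑ z, Γ (orb z υ, i) (orb z υ, i) + ∑ z, γ (orb z υ) (orb z υ) +
        (if i = j then 2 * ∑ z, Γ (orb z υ, i) (orb z υ, i) - ∑ z, γ (orb z υ) (orb z υ) else 0) := by
  by_cases hij : i = j
  · subst hij
    simp only [t2Map_apply, reduceIte, one_mul, Finset.sum_add_distrib, Finset.sum_sub_distrib,
      Finset.sum_const, Finset.card_univ, nsmul_eq_mul]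
    ring
  · simp only [t2Map_apply, reduceIte, if_neg hij, if_neg (Ne.symm hij), one_mul, zero_mul,
      Finset.sum_add_distrib, Finset.sum_sub_distrib, Finset.sum_const, Finset.card_univ,
      nsmul_eq_mul]
    ring

/-- **`T2` class `(σσ; σ)`** (ordered creator sites): `Σ_{x,y,z} T2_{(xσ,yσ;zσ)} =
N_σ((N_σ − 1)(2 − k) + k(k − 1))`. [cite: NakataEtAl2008, §II.A] [cite: Jansson2007, §4 PBQ (ii), p.8] -/
theorem trace_t2Map_spin_same_same (h : IsDQGFeasibleSector a b γ Γ) (σ : Fin 2) :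
    ∑ x, ∑ y, ∑ z, t2Map γ Γ (orb x σ, orb y σ, orb z σ) (orb x σ, orb y σ, orb z σ) =
      ![(a : ℂ), (b : ℂ)] σ *
        ((![(a : ℂ), (b : ℂ)] σ - 1) * (2 - (Fintype.card Λ : ℂ)) +
          (Fintype.card Λ : ℂ) * ((Fintype.card Λ : ℂ) - 1)) := by
  simp_rw [sum_t2Map_diag_spin γ Γ]
  simp only [orb_eq_orb_iff, and_true, if_true, Finset.sum_add_distrib, Finset.sum_sub_distrib,
    Finset.sum_ite_eq, Finset.mem_univ, Finset.sum_const, Finset.card_univ, nsmul_eq_mul,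
    h.sum_sum_two_diag_spin, h.sum_sum_two_diag_spin', h.sum_one_diag_spin, ← Finset.mul_sum]
  ring

/-- **`T2` class `(σσ; τ)`, `σ ≠ τ`**: `Σ_{x,y,z} T2_{(xσ,yσ;zτ)} =
k N_σ(N_σ − 1) − 2(k − 1) N_σ N_τ + k(k − 1) N_τ`.
[cite: NakataEtAl2008, §II.A] [cite: Jansson2007, §4 PBQ (ii), p.8] -/
theorem trace_t2Map_spin_same_other (h : IsDQGFeasibleSector a b γ Γ) {σ τ : Fin 2} (hστ : σ ≠ τ) :
    ∑ x, ∑ y, ∑ z, t2Map γ Γ (orb x σ, orb y σ, orb z τ) (orb x σ, orb y σ, orb z τ) =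
      (Fintype.card Λ : ℂ) * (![(a : ℂ), (b : ℂ)] σ * (![(a : ℂ), (b : ℂ)] σ - 1)) -
        2 * ((Fintype.card Λ : ℂ) - 1) * (![(a : ℂ), (b : ℂ)] σ * ![(a : ℂ), (b : ℂ)] τ) +
        (Fintype.card Λ : ℂ) * ((Fintype.card Λ : ℂ) - 1) * ![(a : ℂ), (b : ℂ)] τ := by
  have hτσ : τ ≠ σ := fun e => hστ e.symm
  simp_rw [sum_t2Map_diag_spin γ Γ]
  simp only [orb_eq_orb_iff, and_true, if_true, hτσ, if_false, Finset.sum_add_distrib,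
    Finset.sum_sub_distrib, Finset.sum_ite_eq, Finset.mem_univ, Finset.sum_const, Finset.card_univ,
    nsmul_eq_mul, h.sum_sum_two_diag_spin, h.sum_sum_two_diag_spin', h.sum_one_diag_spin,
    ← Finset.mul_sum]
  ring

/-- **`T2` class `(στ; τ)`, `σ ≠ τ`**: `Σ_{x,y,z} T2_{(xσ,yτ;zτ)} = k N_τ (k − N_τ + 1)`.
[cite: NakataEtAl2008, §II.A] [cite: Jansson2007, §4 PBQ (ii), p.8] -/
theorem trace_t2Map_spin_other_same (h : IsDQGFeasibleSector a b γ Γ) {σ τ : Fin 2} (hστ : σ ≠ τ) :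
    ∑ x, ∑ y, ∑ z, t2Map γ Γ (orb x σ, orb y τ, orb z τ) (orb x σ, orb y τ, orb z τ) =
      (Fintype.card Λ : ℂ) * ![(a : ℂ), (b : ℂ)] τ * ((Fintype.card Λ : ℂ) - ![(a : ℂ), (b : ℂ)] τ + 1) := by
  have hτσ : τ ≠ σ := fun e => hστ e.symm
  simp_rw [sum_t2Map_diag_spin γ Γ]
  simp only [orb_eq_orb_iff, hστ, hτσ, and_false, if_false, add_zero, Finset.sum_add_distrib,
    Finset.sum_sub_distrib, Finset.sum_const, Finset.card_univ, nsmul_eq_mul,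
    h.sum_sum_two_diag_spin, h.sum_sum_two_diag_spin', h.sum_one_diag_spin, if_true,
    ← Finset.mul_sum]
  ring

/-- **`T2` class `(στ; σ)`, `σ ≠ τ`**: `Σ_{x,y,z} T2_{(xσ,yτ;zσ)} = k N_σ (k − N_σ + 1)`.
[cite: NakataEtAl2008, §II.A] [cite: Jansson2007, §4 PBQ (ii), p.8] -/
theorem trace_t2Map_spin_other_first (h : IsDQGFeasibleSector a b γ Γ) {σ τ : Fin 2} (hστ : σ ≠ τ) :
    ∑ x, ∑ y, ∑ z, t2Map γ Γ (orb x σ, orb y τ, orb z σ) (orb x σ, orb y τ, orb z σ) =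
      (Fintype.card Λ : ℂ) * ![(a : ℂ), (b : ℂ)] σ * ((Fintype.card Λ : ℂ) - ![(a : ℂ), (b : ℂ)] σ + 1) := by
  simp_rw [sum_t2Map_diag_spin γ Γ]
  simp only [orb_eq_orb_iff, hστ, and_false, if_false, add_zero, Finset.sum_add_distrib,
    Finset.sum_sub_distrib, Finset.sum_const, Finset.card_univ, nsmul_eq_mul,
    h.sum_sum_two_diag_spin, h.sum_sum_two_diag_spin', h.sum_one_diag_spin, if_true,
    ← Finset.mul_sum]
  ring

omit [LinearOrder Λ] in
/-- The `T2′` corner block is the 1-matrix: `Σ_x T2′_{inr xσ, inr xσ} = Σ_x γ_{xσ,xσ}` (= `N_σ` in the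
sector, `sum_one_diag_spin`), so the trace of a `T2′` spin class is the sum of its `T2` classes and
`N_σ`. [cite: NakataEtAl2008, §II.B] -/
theorem sum_t2PrimeMap_inr_diag_spin [LinearOrder Λ] (γ : Matrix (Orb Λ) (Orb Λ) ℂ)
    (Γ : Matrix (Orb Λ × Orb Λ) (Orb Λ × Orb Λ) ℂ) (σ : Fin 2) :
    ∑ x, t2PrimeMap γ Γ (Sum.inr (orb x σ)) (Sum.inr (orb x σ)) = ∑ x, γ (orb x σ) (orb x σ) := by
  simp only [t2PrimeMap, Matrix.fromBlocks_apply₂₂]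

omit [LinearOrder Λ] [Fintype Λ] in
/-- The `T2′` principal block is `T2`: `T2′_{inl I, inl J} = T2_{I,J}`, so the `inl`-part of a `T2′`
spin class has the trace of the corresponding `T2` class. [cite: NakataEtAl2008, §II.B] -/
theorem t2PrimeMap_inl_inl [LinearOrder Λ] (γ : Matrix (Orb Λ) (Orb Λ) ℂ)
    (Γ : Matrix (Orb Λ × Orb Λ) (Orb Λ × Orb Λ) ℂ) (I J : Orb Λ × Orb Λ × Orb Λ) :
    t2PrimeMap γ Γ (Sum.inl I) (Sum.inl J) = t2Map γ Γ I J := by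
  simp only [t2PrimeMap, Matrix.fromBlocks_apply₁₁]

/-! ### `T1` classes -/

/-- **`T1` class `(σσσ)`** (ordered sites): `Σ_{x,y,z} T1_{(xσ,yσ,zσ)} =
N_σ(N_σ−1)(N_σ−2) + (k−N_σ)(k−N_σ−1)(k−N_σ−2)` (three `σ`-particles or three `σ`-holes; the `p = 3`
normalisations of the spin-`σ` 3-particle / 3-hole matrices).
[cite: Mazziotti2007CSEChapter, §II.A eq. (8), p.168; §III.B eq. (18), p.172] [cite: NakataEtAl2008, §II.A] -/
theorem trace_t1Map_spin_same (h : IsDQGFeasibleSector a b γ Γ) (σ : Fin 2) :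
    ∑ x, ∑ y, ∑ z, t1Map γ Γ (orb x σ, orb y σ, orb z σ) (orb x σ, orb y σ, orb z σ) =
      ![(a : ℂ), (b : ℂ)] σ * (![(a : ℂ), (b : ℂ)] σ - 1) * (![(a : ℂ), (b : ℂ)] σ - 2) +
        ((Fintype.card Λ : ℂ) - ![(a : ℂ), (b : ℂ)] σ) * ((Fintype.card Λ : ℂ) - ![(a : ℂ), (b : ℂ)] σ - 1) *
          ((Fintype.card Λ : ℂ) - ![(a : ℂ), (b : ℂ)] σ - 2) := by
  simp_rw [t1Map_apply]
  simp only [orb_eq_orb_iff, and_true, if_true, ite_mul, one_mul, zero_mul, mul_ite, mul_one,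
    mul_zero, Finset.sum_add_distrib, Finset.sum_sub_distrib, Finset.sum_ite_irrel, Finset.sum_ite_eq,
    Finset.sum_ite_eq', Finset.mem_univ, Finset.sum_const_zero, Finset.sum_const, Finset.card_univ,
    nsmul_eq_mul, h.sum_sum_two_diag_spin, h.sum_sum_two_transp_spin, h.sum_sum_two_transp_spin',
    h.sum_one_diag_spin, ← Finset.mul_sum]
  ring

/-- **`T1` class `(σστ)`, `σ ≠ τ`** (ordered sites, the odd spin LAST): `Σ_{x,y,z} T1_{(xσ,yσ,zτ)} =
N_σ(N_σ−1)N_τ + (k−N_σ)(k−N_σ−1)(k−N_τ)` (two `σ`-particles and a `τ`-particle, or two `σ`-holes and a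
`τ`-hole). [cite: Mazziotti2007CSEChapter, §II.A eq. (8), p.168; §III.B eq. (18), p.172]
[cite: NakataEtAl2008, §II.A] -/
theorem trace_t1Map_spin_same_same_other (h : IsDQGFeasibleSector a b γ Γ) {σ τ : Fin 2}
    (hστ : σ ≠ τ) :
    ∑ x, ∑ y, ∑ z, t1Map γ Γ (orb x σ, orb y σ, orb z τ) (orb x σ, orb y σ, orb z τ) =
      ![(a : ℂ), (b : ℂ)] σ * (![(a : ℂ), (b : ℂ)] σ - 1) * ![(a : ℂ), (b : ℂ)] τ +
        ((Fintype.card Λ : ℂ) - ![(a : ℂ), (b : ℂ)] σ) * ((Fintype.card Λ : ℂ) - ![(a : ℂ), (b : ℂ)] σ - 1) *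
          ((Fintype.card Λ : ℂ) - ![(a : ℂ), (b : ℂ)] τ) := by
  have hτσ : τ ≠ σ := fun e => hστ e.symm
  simp_rw [t1Map_apply]
  simp only [orb_eq_orb_iff, and_true, hστ, hτσ, and_false, if_false, if_true, ite_mul, one_mul,
    zero_mul, mul_ite, mul_one, mul_zero, Finset.sum_add_distrib, Finset.sum_sub_distrib,
    Finset.sum_ite_irrel, Finset.sum_ite_eq, Finset.sum_ite_eq', Finset.mem_univ, Finset.sum_const_zero,
    Finset.sum_const, Finset.card_univ, nsmul_eq_mul, h.sum_sum_two_diag_spin,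
    h.sum_one_diag_spin, ← Finset.mul_sum]
  ring

/-- **`T1` class `(στσ)`, `σ ≠ τ`** (odd spin in the MIDDLE): the same constant
`N_σ(N_σ−1)N_τ + (k−N_σ)(k−N_σ−1)(k−N_τ)`.
[cite: Mazziotti2007CSEChapter, §II.A eq. (8), p.168; §III.B eq. (18), p.172] [cite: NakataEtAl2008, §II.A] -/
theorem trace_t1Map_spin_same_other_same (h : IsDQGFeasibleSector a b γ Γ) {σ τ : Fin 2}
    (hστ : σ ≠ τ) :
    ∑ x, ∑ y, ∑ z, t1Map γ Γ (orb x σ, orb y τ, orb z σ) (orb x σ, orb y τ, orb z σ) =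
      ![(a : ℂ), (b : ℂ)] σ * (![(a : ℂ), (b : ℂ)] σ - 1) * ![(a : ℂ), (b : ℂ)] τ +
        ((Fintype.card Λ : ℂ) - ![(a : ℂ), (b : ℂ)] σ) * ((Fintype.card Λ : ℂ) - ![(a : ℂ), (b : ℂ)] σ - 1) *
          ((Fintype.card Λ : ℂ) - ![(a : ℂ), (b : ℂ)] τ) := by
  have hτσ : τ ≠ σ := fun e => hστ e.symm
  simp_rw [t1Map_apply]
  simp only [orb_eq_orb_iff, and_true, hστ, hτσ, and_false, if_false, if_true, ite_mul, one_mul,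
    zero_mul, mul_ite, mul_one, mul_zero, Finset.sum_add_distrib, Finset.sum_sub_distrib,
    Finset.sum_ite_eq, Finset.sum_ite_eq', Finset.mem_univ, Finset.sum_const_zero,
    Finset.sum_const, Finset.card_univ, nsmul_eq_mul, h.sum_sum_two_diag_spin,
    h.sum_sum_two_transp_spin, h.sum_sum_two_transp_spin', h.sum_one_diag_spin, ← Finset.mul_sum]
  ring

/-- **`T1` class `(τσσ)`, `σ ≠ τ`** (odd spin FIRST): the same constant
`N_σ(N_σ−1)N_τ + (k−N_σ)(k−N_σ−1)(k−N_τ)`.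
[cite: Mazziotti2007CSEChapter, §II.A eq. (8), p.168; §III.B eq. (18), p.172] [cite: NakataEtAl2008, §II.A] -/
theorem trace_t1Map_spin_other_same_same (h : IsDQGFeasibleSector a b γ Γ) {σ τ : Fin 2}
    (hστ : σ ≠ τ) :
    ∑ x, ∑ y, ∑ z, t1Map γ Γ (orb x τ, orb y σ, orb z σ) (orb x τ, orb y σ, orb z σ) =
      ![(a : ℂ), (b : ℂ)] σ * (![(a : ℂ), (b : ℂ)] σ - 1) * ![(a : ℂ), (b : ℂ)] τ +
        ((Fintype.card Λ : ℂ) - ![(a : ℂ), (b : ℂ)] σ) * ((Fintype.card Λ : ℂ) - ![(a : ℂ), (b : ℂ)] σ - 1) *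
          ((Fintype.card Λ : ℂ) - ![(a : ℂ), (b : ℂ)] τ) := by
  have hτσ : τ ≠ σ := fun e => hστ e.symm
  simp_rw [t1Map_apply]
  simp only [orb_eq_orb_iff, and_true, hστ, hτσ, and_false, if_false, if_true, ite_mul, one_mul,
    zero_mul, mul_ite, mul_one, mul_zero, Finset.sum_add_distrib, Finset.sum_sub_distrib,
    Finset.sum_ite_eq, Finset.sum_ite_eq', Finset.mem_univ, Finset.sum_const_zero,
    Finset.sum_const, Finset.card_univ, nsmul_eq_mul, h.sum_sum_two_diag_spin,
    h.sum_one_diag_spin, ← Finset.mul_sum]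
  ring

end IsDQGFeasibleSector

end Literature.MathematicalPhysics.QuantumChemistry

end
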